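import Summits.AtomisticToContinuum.HydrodynamicLimit.Theses.JParityClosure
import Summits.AtomisticToContinuum.HydrodynamicLimit.Theorems.DensityCap.Negative.MollifiedDensity
import Summits.AtomisticToContinuum.HydrodynamicLimit.Theorems.DensityCap.Negative.KernelMass
import Literature.Analysis.FluidPDE.HardSphereRegularGeometry
import Literature.Analysis.FluidPDE.HardSphereTorusMeasure
import Literature.Analysis.FluidPDE.HardSpherePhaseSpaceProofs
import Literature.Analysis.FunctionSpaces.TorusSpaceTime

/-!
# drefute gen-2: STUB B `stub_eulerDensityModulus` of line `lipschitz-clock-free-past-cap`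
(crux `JParityClosure.DensityCap`, stmt-AtomisticToContinuum-13082) — proof attempt, verbatim signature

Joint smoothness `IsSmoothSpaceTimeOn (Ico 0 T) ρ` = `ContDiffOn` of the space–time lift on
`Ico 0 T ×ˢ univ` ⇒ the lift is uniformly continuous on the compact `Icc 0 t ×ˢ closedBall 0 2` (`t < T`);
points `x, x'` of `𝕋³` lift to `reprSym x` and `reprSym x + reprSym (x' − x)` (norms `≤ √3/2`, `≤ √3 ≤ 2`,
distance `= euclidDist x x'`), which gives the joint modulus (ii); (i) is (ii) at equal times integrated
against the cone kernel (`≥ 0`, supported in `{d < r}`, Haar mass `1` for `r ≤ 1/2`: `integral_cone` +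
`coneMass_eq_one`), the integrability of `y ↦ cone r y x · ρ s y` coming from continuity on the compact torus.
refuter-drefute-stmt-AtomisticToContinuum-13082-g2-0, 2026-08-16.
-/

noncomputable section

namespace DrefuteG2.StubB

open MeasureTheory Filter Set Topology Metric
open scoped BigOperators
open Literature.MathematicalPhysics.KineticTheory Literature.Analysis.FluidPDE
open Literature.Analysis.FunctionSpaces (Torus.IsSmoothSpaceTimeOn Torus.stLift Torus.stLift_apply Torus.proj)
open Summit.AtomisticToContinuum.HydrodynamicLimit.Theorems.DensityCapNegative
  (cone mollDensity cone_nonneg cone_le integral_cone coneMass coneMass_eq_one)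

/-- `‖reprSym x‖ ≤ 1` on `𝕋³` (`≤ √3/2`). -/
theorem norm_reprSym_le_one (x : T3) : ‖Torus.reprSym x‖ ≤ 1 := by
  have h := Torus.norm_reprSym_le_holds x
  rw [Fintype.card_fin] at h
  push_cast at h
  have h3 : Real.sqrt (3 : ℝ) ≤ 2 := by
    rw [show (2 : ℝ) = Real.sqrt (2 ^ 2) from (Real.sqrt_sq (by norm_num)).symm]
    exact Real.sqrt_le_sqrt (by norm_num)
  linarith

/-- The cone kernel is continuous in the particle slot. -/
theorem continuous_cone_left (r : ℝ) (x : T3) : Continuous fun y : T3 => cone r y x := by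
  unfold cone
  simp only [Torus.euclidDist_eq]
  refine continuous_const.mul ((continuous_const.sub ?_).max continuous_const)
  exact (Torus.continuous_norm_reprSym.comp (continuous_id.sub continuous_const)).div_const r

/-- The cone kernel is symmetric. -/
theorem cone_symm (r : ℝ) (x y : T3) : cone r x y = cone r y x := by
  unfold cone
  rw [Torus.euclidDist_comm]

/-- The Haar mass of the cone kernel in the particle slot is `1` (`0 < r ≤ 1/2`). -/
theorem integral_cone_left {r : ℝ} (hr : 0 < r) (hr2 : r ≤ 1 / 2) (x : T3) : ∫ y, cone r y x = 1 := by
  simp_rw [fun y => cone_symm r y x]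
  rw [integral_cone, coneMass_eq_one hr hr2]

/-- A continuous real function on `𝕋³` is integrable for the Haar probability measure. -/
theorem integrable_of_continuous_T3 {f : T3 → ℝ} (hf : Continuous f) : Integrable f volume := by
  obtain ⟨C, hC⟩ := isCompact_univ.exists_bound_of_continuousOn hf.continuousOn
  exact Integrable.of_bound hf.aestronglyMeasurable C (ae_of_all _ fun y => hC y (mem_univ y))

/-- **STUB B — `stub_eulerDensityModulus`, verbatim signature.** -/
theorem stub_eulerDensityModulus {T : ℝ} {ρ : ℝ → T3 → ℝ}
    (hρ : Torus.IsSmoothSpaceTimeOn (Ico 0 T) ρ) {t : ℝ} (ht : t ∈ Ico 0 T) :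
    ∀ η : ℝ, 0 < η → ∃ r₀ : ℝ, 0 < r₀ ∧ r₀ ≤ 1 / 2 ∧
      (∀ r : ℝ, 0 < r → r < r₀ → ∀ s ∈ Icc 0 t, ∀ x : T3, ∫ y, cone r y x * ρ s y ≤ ρ s x + η) ∧
      ∃ τ₀ : ℝ, 0 < τ₀ ∧ ∀ s ∈ Icc 0 t, ∀ s' ∈ Icc 0 t, |s - s'| ≤ τ₀ →
        ∀ x x' : T3, Torus.euclidDist x x' ≤ r₀ → |ρ s x - ρ s' x'| ≤ η := by
  intro η hη
  -- the compact space–time box and uniform continuity of the lift on it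
  set K : Set (ℝ × V3) := Icc 0 t ×ˢ closedBall (0 : V3) 2 with hKdef
  have hK : IsCompact K := isCompact_Icc.prod (isCompact_closedBall 0 2)
  have hKsub : K ⊆ Ico 0 T ×ˢ (univ : Set V3) :=
    prod_mono (Icc_subset_Ico_right ht.2) (subset_univ _)
  have hcont : ContinuousOn (Torus.stLift ρ) K := hρ.continuousOn_stLift.mono hKsub
  obtain ⟨δ, hδ, hUC⟩ := Metric.uniformContinuousOn_iff.1 (hK.uniformContinuousOn_of_continuous hcont) η hη
  -- the joint modulus at scales (δ/2, min (1/2) (δ/2))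
  have hmod : ∀ s ∈ Icc 0 t, ∀ s' ∈ Icc 0 t, |s - s'| ≤ δ / 2 →
      ∀ x x' : T3, Torus.euclidDist x x' ≤ min (1 / 2) (δ / 2) → |ρ s x - ρ s' x'| ≤ η := by
    intro s hs s' hs' hss' x x' hxx'
    set a : V3 := Torus.reprSym x with ha
    set b : V3 := Torus.reprSym (x' - x) with hb
    have ha1 : ‖a‖ ≤ 1 := norm_reprSym_le_one x
    have hb1 : ‖b‖ ≤ 1 := norm_reprSym_le_one (x' - x)
    have hbd : ‖b‖ = Torus.euclidDist x x' := by
      rw [hb, Torus.euclidDist_comm, Torus.euclidDist_eq]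
    have hpK : ((s, a) : ℝ × V3) ∈ K := by
      refine mk_mem_prod hs ?_
      rw [mem_closedBall_zero_iff]
      linarith
    have hqK : ((s', a + b) : ℝ × V3) ∈ K := by
      refine mk_mem_prod hs' ?_
      rw [mem_closedBall_zero_iff]
      exact (norm_add_le a b).trans (by linarith)
    have hdist : dist ((s, a) : ℝ × V3) (s', a + b) < δ := by
      rw [Prod.dist_eq]
      refine max_lt ?_ ?_
      · rw [Real.dist_eq]
        linarith
      · show dist a (a + b) < δ
        rw [dist_comm, dist_eq_norm, add_sub_cancel_left, hbd]
        linarith [min_le_right (1 / 2 : ℝ) (δ / 2)]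
    have h := hUC (s, a) hpK (s', a + b) hqK hdist
    have hp : Torus.stLift ρ (s, a) = ρ s x := by
      rw [Torus.stLift_apply, ha, Torus.proj_reprSym]
    have hq : Torus.stLift ρ (s', a + b) = ρ s' x' := by
      rw [Torus.stLift_apply, Literature.Analysis.FunctionSpaces.Torus.proj_add, ha, hb, Torus.proj_reprSym,
        Torus.proj_reprSym, add_sub_cancel]
    rw [hp, hq, Real.dist_eq] at h
    exact h.le
  refine ⟨min (1 / 2) (δ / 2), lt_min (by norm_num) (by linarith), min_le_left _ _, ?_, δ / 2, by linarith,
    hmod⟩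
  -- (i): integrate (ii) at equal times against the cone kernel
  intro r hr hrr₀ s hs x
  have hr2 : r ≤ 1 / 2 := (hrr₀.le.trans (min_le_left _ _))
  have hsT : s ∈ Ico 0 T := ⟨hs.1, lt_of_le_of_lt hs.2 ht.2⟩
  have hρc : Continuous (ρ s) := (hρ.isSmooth_slice hsT).continuous
  have hgc : Continuous fun y : T3 => cone r y x := continuous_cone_left r x
  have hint1 : Integrable (fun y => cone r y x * ρ s y) volume := integrable_of_continuous_T3 (hgc.mul hρc)
  have hint2 : Integrable (fun y => cone r y x * (ρ s x + η)) volume :=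
    integrable_of_continuous_T3 (hgc.mul continuous_const)
  have hpt : ∀ y, cone r y x * ρ s y ≤ cone r y x * (ρ s x + η) := by
    intro y
    by_cases hd : Torus.euclidDist y x < r
    · refine mul_le_mul_of_nonneg_left ?_ (cone_nonneg hr _ _)
      have hyx : Torus.euclidDist y x ≤ min (1 / 2) (δ / 2) := (hd.le.trans hrr₀.le)
      have := hmod s hs s hs (by simp; positivity) y x hyx
      rw [abs_le] at this
      linarith [this.2]
    · have h0 : cone r y x = 0 := by
        unfold cone
        rw [max_eq_right, mul_zero]
        rw [sub_nonpos, le_div_iff₀ hr, one_mul]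
        exact not_lt.1 hd
      rw [h0, zero_mul, zero_mul]
  calc ∫ y, cone r y x * ρ s y ≤ ∫ y, cone r y x * (ρ s x + η) := integral_mono hint1 hint2 hpt
    _ = (∫ y, cone r y x) * (ρ s x + η) := integral_mul_const _ _
    _ = ρ s x + η := by rw [integral_cone_left hr hr2 x, one_mul]

end DrefuteG2.StubB

end
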